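import Literature.AlgebraicGeometry.Smoothening.NeronDefect
import Mathlib.LinearAlgebra.Dimension.Localization
import Mathlib.RingTheory.Localization.FractionRing
import Mathlib.RingTheory.Localization.Away.Basic
import HarnessLib

/-!
# The generic rank of the pulled-back differentials is unchanged by a dilatation

Topic: `Literature/AlgebraicGeometry/Smoothening` (Bosch–Lütkebohmert–Raynaud, *Néron Models*,
§3.2–3.3: a dilatation `X' → X` is an isomorphism on generic fibres, so `a*Ω¹_{X/R}` and
`a'*Ω¹_{X'/R}` have the same generic rank). Ring-theoretically: let `A` be an `R`-algebra,
`ϖ ∈ R`, `Loc = A[1/ϖ]`, and `A' ⊆ Loc` an `A`-subalgebra of which `Loc` is again the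
localization at `ϖ` (e.g. the dilatation `A[𝔟/ϖ]`, `Dilatations.dilatation.isLocalization_away`).
For compatible points `A → S`, `A' → S` with values in a domain `S` in which `ϖ ≠ 0`,

  `rank_S (S ⊗_A Ω[A⁄R]) = rank_S (S ⊗_{A'} Ω[A'⁄R])`   (`finrank_tensor_kaehler_eq_of_subalgebra`):

both become `K ⊗_{Loc} Ω[Loc⁄R]` after tensoring with `K = Frac S` (differentials commute with
localization, `tensorKaehlerEquivOfIsLocalization`; the rank over a domain is the dimension over
its fraction field, Mathlib `IsLocalizedModule.rank_eq`). The only point requiring care is that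
the two maps `A' → K` (through `S`, and through `Loc`) agree (`algebraMap_eq_lift_of_subalgebra`):
they agree on `A`, and every element of `A'` becomes an element of `A` after multiplication by
a power of `ϖ`, which is a unit in `K`. [folklore]; no named facts (D-0026).

## References

* S. Bosch, W. Lütkebohmert, M. Raynaud, *Néron Models*, Springer 1990, §3.2 (Prop. 1:
  dilatations are isomorphisms on generic fibres), §3.3. [BLRNeronModels1990]
  (Not held; numbers only.)
-/

noncomputable section

open scoped TensorProduct
open KaehlerDifferential

namespace Literature.AlgebraicGeometry.Smoothening

universe u

/-- The rank of a module over a domain `S` is the dimension of its base change to the fraction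
field (Mathlib `IsLocalization.rank_eq` + `IsLocalizedModule.rank_eq`). [folklore] -/
theorem finrank_fractionRing_tensor (S : Type u) [CommRing S] [IsDomain S] (M : Type u)
    [AddCommGroup M] [Module S M] :
    Module.finrank (FractionRing S) (FractionRing S ⊗[S] M) = Module.finrank S M := by
  rw [Module.finrank, Module.finrank,
    IsLocalization.rank_eq (FractionRing S) (nonZeroDivisors S) le_rfl,
    IsLocalizedModule.rank_eq (nonZeroDivisors S) le_rfl (TensorProduct.mk S (FractionRing S) M 1)]

section Subalgebra

variable (R : Type u) [CommRing R] (ϖ : R) (A : Type u) [CommRing A] [Algebra R A]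
  (Loc : Type u) [CommRing Loc] [Algebra R Loc] [Algebra A Loc] [IsScalarTower R A Loc]
  [IsLocalization.Away (algebraMap R A ϖ) Loc]
  (A' : Type u) [CommRing A'] [Algebra R A'] [Algebra A A']
  [Algebra A' Loc] [IsScalarTower A A' Loc] (hinj : Function.Injective (algebraMap A' Loc))
  (K : Type u) [Field K] [Algebra R K] [Algebra A K] [Algebra A' K] [IsScalarTower R A K]
  [IsScalarTower A A' K]

omit [Algebra R Loc] [IsScalarTower R A Loc] [Algebra R A'] in
include hinj in
/-- **The two maps `A' → K` agree.** For an `A`-algebra `A'` mapping injectively to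
`Loc = A[1/ϖ]` over `A` (an `A`-subalgebra of `A[1/ϖ]`): if `ϖ` is non-zero in the field `K`,
the structure map `A' → K` of a point of `Spec A'` compatible with a point `A → K` is the
restriction of the unique extension `A[1/ϖ] → K` of `A → K`. [folklore] -/
theorem algebraMap_eq_lift_of_subalgebra (hϖ : algebraMap R K ϖ ≠ 0) (x : A') :
    algebraMap A' K x =
      IsLocalization.Away.lift (algebraMap R A ϖ) (g := algebraMap A K)
        (by rwa [isUnit_iff_ne_zero, ← IsScalarTower.algebraMap_apply]) (algebraMap A' Loc x) := by
  set φ : Loc →+* K := IsLocalization.Away.lift (algebraMap R A ϖ) (g := algebraMap A K)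
    (by rwa [isUnit_iff_ne_zero, ← IsScalarTower.algebraMap_apply]) with hφ
  obtain ⟨⟨y, ⟨_, n, rfl⟩⟩, hxy⟩ :=
    IsLocalization.surj (Submonoid.powers (algebraMap R A ϖ)) (algebraMap A' Loc x)
  -- `x * ϖ^n = y` in `Loc`
  simp only at hxy
  have hu : IsUnit (algebraMap A K (algebraMap R A ϖ) ^ n) := by
    refine IsUnit.pow n ?_
    rwa [isUnit_iff_ne_zero, ← IsScalarTower.algebraMap_apply]
  refine hu.mul_left_injective ?_
  simp only
  -- right-hand side: `φ x * g(ϖ)^n = φ (x * ϖ^n) = g y`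
  have hr : φ (algebraMap A' Loc x) * algebraMap A K (algebraMap R A ϖ) ^ n = algebraMap A K y := by
    rw [← IsLocalization.Away.lift_eq (S := Loc) (algebraMap R A ϖ) (g := algebraMap A K)
        (by rwa [isUnit_iff_ne_zero, ← IsScalarTower.algebraMap_apply]),
      ← hφ, ← map_pow, ← map_mul, ← map_pow, hxy, hφ,
      IsLocalization.Away.lift_eq (S := Loc)]
  -- left-hand side: through `A'`, where `x * ϖ^n = y` as well
  have hx' : x * algebraMap A A' (algebraMap R A ϖ ^ n) = algebraMap A A' y := by
    apply hinj
    rw [map_mul, ← IsScalarTower.algebraMap_apply A A' Loc, ← IsScalarTower.algebraMap_apply A A' Loc]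
    exact hxy
  have hl : algebraMap A' K x * algebraMap A K (algebraMap R A ϖ) ^ n = algebraMap A K y := by
    rw [← map_pow, IsScalarTower.algebraMap_apply A A' K, ← map_mul, hx',
      ← IsScalarTower.algebraMap_apply A A' K]
  rw [hl, hr]

variable [IsLocalization.Away (algebraMap R A' ϖ) Loc] [IsScalarTower R A' Loc]

include hinj in
/-- **The generic rank of the pulled-back differentials is the same on `Spec A` and on
`Spec A'`** for an `A`-algebra `A'` injecting into `A[1/ϖ]` with `A'[1/ϖ] = A[1/ϖ]` (e.g. a
dilatation) and compatible points with values in a domain `S` with `ϖ ≠ 0` in `S`: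
`rank_S (S ⊗_A Ω[A⁄R]) = rank_S (S ⊗_{A'} Ω[A'⁄R])`. [folklore] -/
theorem finrank_tensor_kaehler_eq_of_subalgebra (S : Type u) [CommRing S] [IsDomain S]
    [Algebra R S] [Algebra A S] [Algebra A' S] [IsScalarTower R A S] [IsScalarTower A A' S]
    (hϖ : algebraMap R S ϖ ≠ 0) :
    Module.finrank S (S ⊗[A] Ω[A⁄R]) = Module.finrank S (S ⊗[A'] Ω[A'⁄R]) := by
  let K := FractionRing S
  -- `K` is an `A`-, `A'`-algebra through `S` (Mathlib `Localization.instAlgebra`)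
  haveI : IsScalarTower R A K := IsScalarTower.of_algebraMap_eq fun r => by
    rw [IsScalarTower.algebraMap_apply A S K, ← IsScalarTower.algebraMap_apply R A S,
      ← IsScalarTower.algebraMap_apply R S K]
  haveI : IsScalarTower A A' K := IsScalarTower.of_algebraMap_eq fun a => by
    rw [IsScalarTower.algebraMap_apply A S K, IsScalarTower.algebraMap_apply A' S K,
      ← IsScalarTower.algebraMap_apply A A' S]
  have hϖK : algebraMap R K ϖ ≠ 0 := by
    rw [IsScalarTower.algebraMap_apply R S K]
    exact (map_ne_zero_iff _ (IsFractionRing.injective S K)).mpr hϖ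
  have hunit : IsUnit (algebraMap A K (algebraMap R A ϖ)) := by
    rwa [isUnit_iff_ne_zero, ← IsScalarTower.algebraMap_apply]
  -- `K` as a `Loc`-algebra
  letI : Algebra Loc K := (IsLocalization.Away.lift (algebraMap R A ϖ) hunit : Loc →+* K).toAlgebra
  haveI : IsScalarTower A Loc K := IsScalarTower.of_algebraMap_eq fun a =>
    (IsLocalization.Away.lift_eq (S := Loc) (algebraMap R A ϖ) hunit a).symm
  haveI : IsScalarTower A' Loc K := IsScalarTower.of_algebraMap_eq fun x =>
    algebraMap_eq_lift_of_subalgebra R ϖ A Loc A' hinj K hϖK x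
  -- both sides become `K ⊗_{Loc} Ω[Loc⁄R]` over `K`
  have e₁ : K ⊗[S] (S ⊗[A] Ω[A⁄R]) ≃ₗ[K] K ⊗[Loc] Ω[Loc⁄R] :=
    (TensorProduct.AlgebraTensorModule.cancelBaseChange A S K K Ω[A⁄R]).trans
      (tensorKaehlerEquivOfIsLocalization R A Loc (Submonoid.powers (algebraMap R A ϖ)) K)
  have e₂ : K ⊗[S] (S ⊗[A'] Ω[A'⁄R]) ≃ₗ[K] K ⊗[Loc] Ω[Loc⁄R] :=
    (TensorProduct.AlgebraTensorModule.cancelBaseChange A' S K K Ω[A'⁄R]).trans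
      (tensorKaehlerEquivOfIsLocalization R A' Loc (Submonoid.powers (algebraMap R A' ϖ)) K)
  rw [← finrank_fractionRing_tensor S (S ⊗[A] Ω[A⁄R]),
    ← finrank_fractionRing_tensor S (S ⊗[A'] Ω[A'⁄R]), e₁.finrank_eq, e₂.finrank_eq]

end Subalgebra

end Literature.AlgebraicGeometry.Smoothening
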